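import Summits.QuantumFields.YangMills.Theorems.LuscherReductionTwistedTraceScalingFloorConstants
import HarnessLib

/-!
# The POINTWISE SUB-SOLUTION BOUND of the k = 0 FLOOR at a near-vacuum step: `(K_β ψ)(W) ≥ m·ψ(W) − r`
# (lane A of S-BASE, crux `TwistedTraceScaling` stmt-QuantumFields-20203; design note `pub/ym-fleet/ym-luscher-20007-p1/COARSE-DESIGN.md` §18)

`ψ = floorTrial β μ γ = H·G` (`…FloorTube`); constants `floorCK`, `riccatiTrialErr`, `chartMove`, `floorDefect`, `floorTail`, `floorModel` (`…FloorConstants`).  At a near-vacuum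
step `W` (links in the upper hemisphere, vector parts `≤ τ ≤ 1/30`, `d_tor W ≤ τ_d`), with lane B's chart data (`0 ≤ ρ ≤ 1/100`, `δ < 1`, `(1−δ)²(1+ρ²) ≤ 1`), the tube action
level `tubeSigma L τ ≤ 1/16`, and the softness window `2(√μ + 504τ√N)² ≤ 2 − 2cos(2π/L)` (`L ≥ 2`):
* §1 ★★ `floorModel_closed_ge` — `e^{−floorDefect}·√(π/β)^{3|E|}·e^{−6·toronZPE L (1/2) 0 0}·H(W) ≤ e^{−(β/2)S(W)}·∫ floorModel β μ W`: the closed form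
  `Harm.integral_harmonicStep_weightForm` at `b = β`, bounded below mode by mode — potential/Bianchi defect (`Harm.exp_potential_defect_ge`, `…FloorTube` geometry
  `F(W) = D_W w + O(τ²)`, `S − ‖F‖² ≤ N_P(837τ²)²`), normal-mode product (`Harm.prod_gram_riccati_ge_zpeSum` + second-order softness `Toron.gram_soft_le_of_near_vacuum` +
  `zpeSum_near_vacuum_le`), soft sub-solution defect (`Harm.sum_softDefect_le`);
* §2 ★★★ `floor_subsolution_near` —
  `(K_β ψ)(W) ≥ floorCK · e^{−riccatiTrialErr} · e^{−γ(2τ_d δ₁ + δ₁²)} · e^{−floorDefect} · √(π/β)^{3|E|} · e^{−6·toronZPE L (1/2) 0 0} · ψ(W) − floorCK · floorTail`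
  (lane B's `Cov.model_le_transferApply` + `lowerModel_floorTrial_ge` + `integral_chartBall_ge` + §1).
Every defect is `O(βτ⁴ + τ)·(lattice constants)`: `o(1)` uniformly on the tube `τ ≤ β^{−1/3}` — the floor at relative precision `e^{−o(β^{−p})}`, `p < 1/3`.
HONEST FRAMING: fixed-lattice Gaussian bookkeeping for a stub lane of a child of the CONDITIONAL reduction route (femto rung R2b1); not infinite volume, not a gap, not Clay.

## References
* M. Lüscher, Nucl. Phys. B219 (1983) 233, §3. [Luscher1983]
* A. Wipf, LNP 992 (2021), §8.5. [Wipf2021]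
-/

set_option autoImplicit false

noncomputable section

open MeasureTheory Real Finset
open scoped BigOperators RealInnerProductSpace
open Literature.MathematicalPhysics.QuantumFieldTheory
open Literature.MathematicalPhysics.QuantumLattice

namespace Summit.QuantumFields.YangMills.Theorems.FemtoTransferGap

open TwoLattice TwoLattice.Toron TwoLattice.Cov TwoLattice.Stiff TwoLattice.Harm TwoLattice.GnChart TwoLattice.Flat

variable {L : ℕ} [NeZero L]

/-! ## §1 The closed form at a near-vacuum step, bounded below -/

/-- ★★ **The all-space model integral of the floor at a near-vacuum step, BOUNDED BELOW** (`L ≥ 2`, upper hemisphere, vector parts `≤ τ ≤ 1/30`,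
`2(√μ + 504τ√N)² ≤ 2 − 2cos(2π/L)`):
`e^{−floorDefect}·√(π/β)^{3|E|}·e^{−6·toronZPE L (1/2) 0 0}·H(W) ≤ e^{−(β/2)S(W)}·∫ floorModel β μ W`. [cite: Luscher1983, §3] [cite: Wipf2021, §8.5.2] -/
theorem floorModel_closed_ge (hL : 2 ≤ L) {β μ τ : ℝ} (hβ : 0 < β) (hμ : 0 < μ) (hτ : τ ≤ 1 / 30) {W : GaugeConfig 3 L SU2}
    (hs : ∀ e : Edge 3 L, 0 ≤ scalarPart (W e)) (hw : ∀ (e : Edge 3 L) (c : Fin 3), |vecPart (W e) c| ≤ τ)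
    (hgap : 2 * (Real.sqrt μ + 504 * τ * Real.sqrt (Fintype.card (Plaquette 3 L × Fin 3))) ^ 2 ≤ 2 - 2 * Real.cos (2 * Real.pi / L)) :
    Real.exp (-floorDefect L β μ τ) * (Real.sqrt (Real.pi / β) ^ (Fintype.card (Edge 3 L) * 3) * Real.exp (-(6 * toronZPE L (1 / 2) 0 0))) *
        stiffTrial (riccatiWeight (β / 2) β μ) W ≤
      Real.exp (-(β / 2) * wilsonAction su2Rep W) * ∫ x, floorModel β μ W x := by
  classical
  -- abbreviations
  set N : ℝ := (Fintype.card (Plaquette 3 L × Fin 3) : ℝ) with hN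
  set n : ℝ := (Fintype.card (Edge 3 L × Fin 3) : ℝ) with hn
  set NP : ℝ := (Fintype.card (Plaquette 3 L) : ℝ) with hNP
  set t : ℝ := β / 2 with ht
  set ĝ : ℝ := Real.sqrt (t ^ 2 + 2 * t * β / μ) with hĝ
  set g : ℝ → ℝ := riccatiWeight t β μ with hgdef
  set ε : ℝ := 504 * τ * Real.sqrt N with hε
  set Λ : ℝ := 2 * ε ^ 2 with hΛ
  set r₁ : ℝ := 288 * τ ^ 2 * Real.sqrt N + ε * (τ * Real.sqrt n) with hr₁
  set a : ℝ := 2 * t + t ^ 2 * μ / β with ha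
  set cs : ℝ := (t + ĝ) / (2 * β) with hcs
  set Z₀ : ℝ := 6 * toronZPE L (1 / 2) 0 0 with hZ₀
  set n3 : ℕ := Fintype.card (Edge 3 L) * 3 with hn3
  have hDef : floorDefect L β μ τ = t * (NP * (837 * τ ^ 2) ^ 2) + β * r₁ ^ 2 + (n3 : ℝ) * (cs * Λ) +
      (n3 : ℝ) * (Real.sqrt (1 / 2 / 2) * ε) + 2 * a * (Λ * (τ * Real.sqrt n) ^ 2 + r₁ ^ 2) := by
    rw [floorDefect]
  -- signs
  have hτ0 : 0 ≤ τ := (abs_nonneg _).trans (hw default 0)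
  have hτ1 : τ ≤ 1 := by linarith
  have ht0 : 0 ≤ t := by positivity
  have hg0 : ∀ s, 0 ≤ g s := fun s => riccatiWeight_nonneg hμ s
  have hε0 : 0 ≤ ε := by positivity
  have hΛ0 : 0 ≤ Λ := by positivity
  have ha0 : 0 ≤ a := by positivity
  -- the tube geometry at `W`
  have hS0 : 0 ≤ wilsonAction su2Rep W := (sq_nonneg _).trans (norm_plaqCurv_sq_le_wilsonAction W)
  have hEop : ∀ x, ‖covCurl W x - covCurl (1 : GaugeConfig 3 L SU2) x‖ ≤ ε * ‖x‖ := norm_covCurl_sub_vacuum_le hτ1 hw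
  set w₀ : LinkSpace L := linkVec L W with hw₀
  set r : PlaqSpace L := plaqCurv W - covCurl W w₀ with hrdef
  have hF : plaqCurv W = covCurl W w₀ + r := by rw [hrdef]; abel
  have hw₀n : ‖w₀‖ ≤ τ * Real.sqrt n := norm_linkVec_le hw
  have hrn : ‖r‖ ≤ r₁ := norm_plaqCurv_sub_covCurl_linkVec_le hτ hs hw
  have hr₁0 : 0 ≤ r₁ := (norm_nonneg _).trans hrn
  have hSF : wilsonAction su2Rep W - ‖plaqCurv W‖ ^ 2 ≤ NP * (837 * τ ^ 2) ^ 2 := wilsonAction_sub_norm_plaqCurv_sq_le hτ hs hw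
  have hZ : zpeSum L (1 / 2) W ≤ Z₀ + (n3 : ℝ) * (Real.sqrt (1 / 2 / 2) * ε) := zpeSum_near_vacuum_le hτ1 hw (by norm_num)
  -- Gram eigenframe of `D_W`
  set lam := (gramMatrix_isHermitian (covCurl W)).eigenvalues with hlam
  set e := (gramMatrix_isHermitian (covCurl W)).eigenvectorBasis with he
  have hDfr := gram_frame (covCurl W)
  have hlam0 : ∀ i, 0 ≤ lam i := fun i => gram_eigenvalues_nonneg (covCurl W) i
  have hsoft : ∀ i, lam i < μ → lam i ≤ Λ := fun i hi => gram_soft_le_of_near_vacuum hL W hε0 hEop hgap i hi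
  -- the closed form
  set φ : Edge 3 L × Fin 3 → ℝ := fun i => ⟪covCurl W (e i), plaqCurv W⟫ with hφ
  set κ : Edge 3 L × Fin 3 → ℝ := fun i => stepGain (lam i) t β (g (lam i)) with hκ
  have h3 : ∫ x, floorModel β μ W x = Real.exp (-(t * ‖plaqCurv W‖ ^ 2)) *
      ∏ i, Real.sqrt (π / (t * lam i + β + g (lam i) * lam i ^ 2)) * Real.exp (2 * t * φ i ^ 2 / lam i) *
        Real.exp (-(κ i * (φ i / lam i) ^ 2)) * Real.exp (-(g (lam i) * φ i ^ 2)) := by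
    have := integral_harmonicStep_weightForm (covCurl W) hg0 ht0 hβ (plaqCurv W)
    simpa only [floorModel] using this
  set P₀ : ℝ := ∏ i, Real.sqrt (π / (t * lam i + β + g (lam i) * lam i ^ 2)) with hP₀
  have hP₀0 : 0 ≤ P₀ := Finset.prod_nonneg fun i _ => Real.sqrt_nonneg _
  have hprod : (∏ i, Real.sqrt (π / (t * lam i + β + g (lam i) * lam i ^ 2)) * Real.exp (2 * t * φ i ^ 2 / lam i) *
        Real.exp (-(κ i * (φ i / lam i) ^ 2)) * Real.exp (-(g (lam i) * φ i ^ 2))) =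
      P₀ * Real.exp (∑ i, 2 * t * φ i ^ 2 / lam i) * Real.exp (-(∑ i, κ i * (φ i / lam i) ^ 2)) * Real.exp (-(∑ i, g (lam i) * φ i ^ 2)) := by
    rw [hP₀, Real.exp_sum, ← Finset.sum_neg_distrib, Real.exp_sum, ← Finset.sum_neg_distrib, Real.exp_sum, ← Finset.prod_mul_distrib,
      ← Finset.prod_mul_distrib, ← Finset.prod_mul_distrib]
  have hHW : stiffTrial g W = Real.exp (-(∑ i, g (lam i) * φ i ^ 2)) := by
    unfold stiffTrial; rw [weightForm_eq_sum g (covCurl W) hDfr (plaqCurv W)]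
  -- (a) potential + Bianchi defect
  have h4a : Real.exp (-(t * (NP * (837 * τ ^ 2) ^ 2))) * Real.exp (-(β * r₁ ^ 2)) ≤
      Real.exp (-t * wilsonAction su2Rep W) * (Real.exp (-(t * ‖plaqCurv W‖ ^ 2)) * Real.exp (∑ i, 2 * t * φ i ^ 2 / lam i)) := by
    refine le_trans ?_ (exp_potential_defect_ge hDfr ht0 (plaqCurv W) w₀ (wilsonAction su2Rep W))
    rw [← Real.exp_add, ← Real.exp_add, Real.exp_le_exp]
    have h5 : ‖plaqCurv W - covCurl W w₀‖ ≤ r₁ := by rw [← hrdef]; exact hrn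
    have h6 : ‖plaqCurv W - covCurl W w₀‖ ^ 2 ≤ r₁ ^ 2 := pow_le_pow_left₀ (norm_nonneg _) h5 2
    have h7 : 2 * t = β := by rw [ht]; ring
    rw [h7]
    have h8 := mul_le_mul_of_nonneg_left hSF ht0
    have h9 := mul_le_mul_of_nonneg_left h6 hβ.le
    linarith
  -- (b) the normal-mode product
  have h4b : Real.sqrt (Real.pi / β) ^ n3 * Real.exp (-zpeSum L (1 / 2) W) * Real.exp (-((n3 : ℝ) * (cs * Λ))) ≤ P₀ := by
    have h := prod_gram_riccati_ge_zpeSum W ht0 hβ hμ hΛ0 hsoft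
    have htb : t / β = 1 / 2 := by rw [ht]; field_simp
    rw [htb] at h
    rw [hP₀, hcs, hĝ]
    exact h
  have h4b' : Real.exp (-Z₀) * Real.exp (-((n3 : ℝ) * (Real.sqrt (1 / 2 / 2) * ε))) ≤ Real.exp (-zpeSum L (1 / 2) W) := by
    rw [← Real.exp_add, Real.exp_le_exp]; linarith
  -- (c) the soft sub-solution defect
  have h4c : Real.exp (-(2 * a * (Λ * (τ * Real.sqrt n) ^ 2 + r₁ ^ 2))) ≤ Real.exp (-(∑ i, κ i * (φ i / lam i) ^ 2)) := by
    rw [Real.exp_le_exp, neg_le_neg_iff]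
    have hκ0 : ∀ i, 0 ≤ κ i := fun i =>
      stepGain_nonneg_of_le (hlam0 i) ht0 hβ (hg0 _) (riccatiWeight_sq_le hμ ht0 hβ.le (hlam0 i))
    have hκ1 : ∀ i, κ i ≤ a * lam i := by
      intro i
      by_cases hle : μ ≤ lam i
      · have h0 : κ i = 0 := stepGain_eq_zero_of_riccati (riccatiWeight_riccati hμ ht0 hβ.le hle)
        rw [h0]; exact mul_nonneg ha0 (hlam0 i)
      · push Not at hle
        refine (stepGain_le_mul (hlam0 i) ht0 hβ (hg0 (lam i))).trans ?_
        rw [ha, mul_comm]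
        refine mul_le_mul_of_nonneg_right ?_ (hlam0 i)
        have : t ^ 2 * lam i / β ≤ t ^ 2 * μ / β := by gcongr
        linarith
    have hκ2 : ∀ i, κ i ≤ a * Λ := by
      intro i
      by_cases hle : μ ≤ lam i
      · have h0 : κ i = 0 := stepGain_eq_zero_of_riccati (riccatiWeight_riccati hμ ht0 hβ.le hle)
        rw [h0]; positivity
      · push Not at hle
        exact (hκ1 i).trans (mul_le_mul_of_nonneg_left (hsoft i hle) ha0)
    have h := sum_softDefect_le hDfr ha0 hκ0 hκ1 hκ2 w₀ r
    rw [← hF] at h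
    refine h.trans (mul_le_mul_of_nonneg_left ?_ (by positivity))
    have h1 : ‖w₀‖ ^ 2 ≤ (τ * Real.sqrt n) ^ 2 := pow_le_pow_left₀ (norm_nonneg _) hw₀n 2
    have h2 : ‖r‖ ^ 2 ≤ r₁ ^ 2 := pow_le_pow_left₀ (norm_nonneg _) hrn 2
    have h3 := mul_le_mul_of_nonneg_left h1 hΛ0
    linarith
  -- assemble
  have hB10 : 0 ≤ Real.exp (-t * wilsonAction su2Rep W) * (Real.exp (-(t * ‖plaqCurv W‖ ^ 2)) * Real.exp (∑ i, 2 * t * φ i ^ 2 / lam i)) := by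
    positivity
  have hA2 : Real.sqrt (Real.pi / β) ^ n3 * (Real.exp (-Z₀) * Real.exp (-((n3 : ℝ) * (Real.sqrt (1 / 2 / 2) * ε)))) *
      Real.exp (-((n3 : ℝ) * (cs * Λ))) ≤ P₀ :=
    le_trans (mul_le_mul_of_nonneg_right (mul_le_mul_of_nonneg_left h4b' (by positivity)) (Real.exp_pos _).le) h4b
  have hineq := mul_le_mul_of_nonneg_right (mul_le_mul (mul_le_mul h4a hA2 (by positivity) hB10) h4c (by positivity) (mul_nonneg hB10 hP₀0))
    (stiffTrial_pos g W).le
  have hEq : Real.exp (-t * wilsonAction su2Rep W) * ∫ x, floorModel β μ W x =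
      Real.exp (-t * wilsonAction su2Rep W) * (Real.exp (-(t * ‖plaqCurv W‖ ^ 2)) * Real.exp (∑ i, 2 * t * φ i ^ 2 / lam i)) * P₀ *
        Real.exp (-(∑ i, κ i * (φ i / lam i) ^ 2)) * stiffTrial g W := by
    rw [h3, hprod, hHW]; ring
  have heD : Real.exp (-floorDefect L β μ τ) * (Real.sqrt (Real.pi / β) ^ n3 * Real.exp (-Z₀)) =
      Real.exp (-(t * (NP * (837 * τ ^ 2) ^ 2))) * Real.exp (-(β * r₁ ^ 2)) *
        (Real.sqrt (Real.pi / β) ^ n3 * (Real.exp (-Z₀) * Real.exp (-((n3 : ℝ) * (Real.sqrt (1 / 2 / 2) * ε)))) * Real.exp (-((n3 : ℝ) * (cs * Λ)))) *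
        Real.exp (-(2 * a * (Λ * (τ * Real.sqrt n) ^ 2 + r₁ ^ 2))) := by
    have hexp : Real.exp (-floorDefect L β μ τ) = Real.exp (-(t * (NP * (837 * τ ^ 2) ^ 2))) * Real.exp (-(β * r₁ ^ 2)) *
        (Real.exp (-((n3 : ℝ) * (Real.sqrt (1 / 2 / 2) * ε))) * Real.exp (-((n3 : ℝ) * (cs * Λ)))) *
        Real.exp (-(2 * a * (Λ * (τ * Real.sqrt n) ^ 2 + r₁ ^ 2))) := by
      rw [hDef, ← Real.exp_add, ← Real.exp_add, ← Real.exp_add, ← Real.exp_add]; congr 1; ring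
    rw [hexp]; ring
  have ht' : -(β / 2) * wilsonAction su2Rep W = -t * wilsonAction su2Rep W := by rw [ht]
  rw [ht', hEq, heD]
  exact hineq

/-! ## §2 ★★★ The sub-solution bound -/

/-- ★★★ **THE POINTWISE SUB-SOLUTION BOUND OF THE FLOOR** at a near-vacuum step (see the module docstring). [cite: Luscher1983, §3] [cite: Wipf2021, §8.5.2] -/
theorem floor_subsolution_near (hL : 2 ≤ L) {β μ γ ρ δ τ τd : ℝ} (hβ : 0 < β) (hμ : 0 < μ) (hγ : 0 ≤ γ) (hδ : δ < 1) (hρ0 : 0 ≤ ρ)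
    (hρ : ρ ≤ 1 / 100) (hρδ : (1 - δ) ^ 2 * (1 + ρ ^ 2) ≤ 1) (hτ : τ ≤ 1 / 30) {W : GaugeConfig 3 L SU2}
    (hs : ∀ e : Edge 3 L, 0 ≤ scalarPart (W e)) (hw : ∀ (e : Edge 3 L) (c : Fin 3), |vecPart (W e) c| ≤ τ)
    (hσ : tubeSigma L τ ≤ 1 / 16)
    (hgap : 2 * (Real.sqrt μ + 504 * τ * Real.sqrt (Fintype.card (Plaquette 3 L × Fin 3))) ^ 2 ≤ 2 - 2 * Real.cos (2 * Real.pi / L))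
    (hτd : torDist W ≤ τd) :
    floorCK L β ρ τ * (Real.exp (-riccatiTrialErr L β μ ρ (tubeSigma L τ)) * Real.exp (-(γ * (2 * τd * chartMove L ρ + chartMove L ρ ^ 2))) *
        Real.exp (-floorDefect L β μ τ) * (Real.sqrt (Real.pi / β) ^ (Fintype.card (Edge 3 L) * 3) * Real.exp (-(6 * toronZPE L (1 / 2) 0 0))) *
        floorTrial β μ γ W) - floorCK L β ρ τ * floorTail L β ρ
      ≤ transferApply β (floorTrial β μ γ) W := by
  set CK : ℝ := floorCK L β ρ τ with hCK
  set E : ℝ := riccatiTrialErr L β μ ρ (tubeSigma L τ) with hE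
  set γ' : ℝ := γ * (2 * τd * chartMove L ρ + chartMove L ρ ^ 2) with hγ'
  set D : ℝ := floorDefect L β μ τ with hD
  set T : ℝ := floorTail L β ρ with hT
  set Q : ℝ := Real.sqrt (Real.pi / β) ^ (Fintype.card (Edge 3 L) * 3) * Real.exp (-(6 * toronZPE L (1 / 2) 0 0)) with hQ
  set ψ : GaugeConfig 3 L SU2 → ℝ := floorTrial β μ γ with hψ
  set H : GaugeConfig 3 L SU2 → ℝ := stiffTrial (riccatiWeight (β / 2) β μ) with hH
  set G : GaugeConfig 3 L SU2 → ℝ := floorCutoff γ with hG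
  have hψ_eq : ψ W = H W * G W := rfl
  -- signs
  have hτ0 : 0 ≤ τ := (abs_nonneg _).trans (hw default 0)
  have hCK0 : 0 ≤ CK := floorCK_nonneg β ρ τ
  have hT0 : 0 ≤ T := floorTail_nonneg hβ ρ
  have hE0 : 0 ≤ E := riccatiTrialErr_nonneg hμ hρ0 hβ.le
  have hγ'0 : 0 ≤ γ' := by
    have h1 := chartMove_nonneg (L := L) hρ0
    have h0 : 0 ≤ τd := (torDist_nonneg W).trans hτd
    positivity
  have hG0 : 0 ≤ G W := (floorCutoff_pos γ W).le
  have hS : wilsonAction su2Rep W ≤ tubeSigma L τ := by rw [tubeSigma]; exact wilsonAction_near_vacuum_le hτ hs hw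
  have hS0 : 0 ≤ wilsonAction su2Rep W := (sq_nonneg _).trans (norm_plaqCurv_sq_le_wilsonAction W)
  -- Step 1: lane B's lower model
  have h1 : CK * Real.exp (-(β / 2) * wilsonAction su2Rep W) * (∫ x, lowerModel β ρ ψ W x) ≤ transferApply β ψ W := by
    have h := model_le_transferApply hβ.le hδ hρ0 hρ hρδ hσ (measurable_floorTrial β hμ hγ) (fun V => (floorTrial_pos β μ γ V).le) (C := 1)
      (fun V => floorTrial_le_one hμ hγ V) W hS
    rw [hCK, floorCK]
    exact h
  -- Step 2: the lower model against `ψ` dominates the cut Gaussian model, integrated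
  have h2 : Real.exp (-E) * (G W * Real.exp (-γ')) * ∫ x, (chartBall L ρ).indicator (floorModel β μ W) x ≤ ∫ x, lowerModel β ρ ψ W x := by
    rw [← integral_const_mul]
    refine integral_mono_of_nonneg (ae_of_all _ fun x => ?_) (integrable_lowerModel_floorTrial hβ hμ hγ W) (ae_of_all _ fun x => ?_)
    · exact mul_nonneg (by positivity) (Set.indicator_nonneg (fun y _ => (floorModel_nonneg_le hβ.le hμ W y).1) x)
    · exact lowerModel_floorTrial_ge hβ hμ hγ hρ0 (by linarith) hσ W hS hτd x
  -- Step 3: ball = all space − tail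
  have hball : (∫ x, floorModel β μ W x) - T ≤ ∫ x, (chartBall L ρ).indicator (floorModel β μ W) x :=
    integral_chartBall_ge hβ hρ0 (integrable_floorModel hβ hμ W) (fun x => (floorModel_nonneg_le hβ.le hμ W x).1) (fun x => (floorModel_nonneg_le hβ.le hμ W x).2)
  -- Step 4: the closed form bounded below
  have h4 : Real.exp (-D) * Q * H W ≤ Real.exp (-(β / 2) * wilsonAction su2Rep W) * ∫ x, floorModel β μ W x :=
    floorModel_closed_ge hL hβ hμ hτ hs hw hgap
  -- assemble: the main term
  have hmain : CK * (Real.exp (-E) * Real.exp (-γ') * Real.exp (-D) * Q * ψ W) ≤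
      CK * Real.exp (-(β / 2) * wilsonAction su2Rep W) * (Real.exp (-E) * (G W * Real.exp (-γ')) * ∫ x, floorModel β μ W x) := by
    have hkey := mul_le_mul_of_nonneg_left h4 (show 0 ≤ CK * (Real.exp (-E) * (G W * Real.exp (-γ'))) by positivity)
    rw [hψ_eq]
    calc CK * (Real.exp (-E) * Real.exp (-γ') * Real.exp (-D) * Q * (H W * G W))
        = CK * (Real.exp (-E) * (G W * Real.exp (-γ'))) * (Real.exp (-D) * Q * H W) := by ring
      _ ≤ CK * (Real.exp (-E) * (G W * Real.exp (-γ'))) * (Real.exp (-(β / 2) * wilsonAction su2Rep W) * ∫ x, floorModel β μ W x) := hkey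
      _ = _ := by ring
  -- the remainder
  have hrem : CK * Real.exp (-(β / 2) * wilsonAction su2Rep W) * (Real.exp (-E) * (G W * Real.exp (-γ'))) * T ≤ CK * T := by
    refine mul_le_mul_of_nonneg_right ?_ hT0
    have h1' : Real.exp (-(β / 2) * wilsonAction su2Rep W) ≤ 1 := by
      rw [Real.exp_le_one_iff, neg_mul, neg_nonpos]; positivity
    have h2' : Real.exp (-E) ≤ 1 := by rw [Real.exp_le_one_iff, neg_nonpos]; exact hE0
    have h3' : G W ≤ 1 := floorCutoff_le_one hγ W
    have h4' : Real.exp (-γ') ≤ 1 := by rw [Real.exp_le_one_iff, neg_nonpos]; exact hγ'0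
    calc CK * Real.exp (-(β / 2) * wilsonAction su2Rep W) * (Real.exp (-E) * (G W * Real.exp (-γ')))
        ≤ CK * 1 * (1 * (1 * 1)) := by gcongr
      _ = CK := by ring
  -- Steps 1–3 chained
  have hchain : CK * Real.exp (-(β / 2) * wilsonAction su2Rep W) * (Real.exp (-E) * (G W * Real.exp (-γ')) * ((∫ x, floorModel β μ W x) - T)) ≤
      transferApply β ψ W := by
    have h2' : Real.exp (-E) * (G W * Real.exp (-γ')) * ((∫ x, floorModel β μ W x) - T) ≤ ∫ x, lowerModel β ρ ψ W x :=
      le_trans (mul_le_mul_of_nonneg_left hball (by positivity)) h2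
    exact le_trans (mul_le_mul_of_nonneg_left h2' (by positivity)) h1
  have hsplit : CK * Real.exp (-(β / 2) * wilsonAction su2Rep W) * (Real.exp (-E) * (G W * Real.exp (-γ')) * ((∫ x, floorModel β μ W x) - T)) =
      CK * Real.exp (-(β / 2) * wilsonAction su2Rep W) * (Real.exp (-E) * (G W * Real.exp (-γ')) * ∫ x, floorModel β μ W x) -
        CK * Real.exp (-(β / 2) * wilsonAction su2Rep W) * (Real.exp (-E) * (G W * Real.exp (-γ'))) * T := by ring
  linarith [hmain, hrem, hchain, hsplit]

end Summit.QuantumFields.YangMills.Theorems.FemtoTransferGap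

end
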